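import Literature.Analysis.FluidPDE.NSBootstrapInduction
import Literature.Analysis.FluidPDE.BoundedWeakDerivativesSmooth
import HarnessLib

/-!
# The Serrin bootstrap: smooth slices

Analysis/FluidPDE proofs file (theorems only). From the level data of all orders
(`NSBootstrap.all_levels`) the velocity slices `u(t, ·)` of a bounded distributional
Navier–Stokes solution are, for a.e. time of an inner cylinder, a.e. equal to smooth functions
with all derivatives bounded by constants fixed before the solution (`ae_smooth_slices`):
slicing the represented derivatives in time (`RepDeriv.ae_slice_firstOrder`) produces, for
a.e. `t`, a family with bounded weak derivatives of all orders on the ball, to which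
`WkInfty.exists_smooth_rep` applies (Seregin–Šverák 2009, §2 p. 8: "Differentiability in `t` is
worse. But we can state that all derivatives `∇ᵏu` are Hölder continuous … in the closure of
`Q(3/4)`" — here the spatial part).

## References

* G. Seregin, V. Šverák, Comm. PDE 34 (2009) = arXiv:0804.1803, §2 p. 8. [`SereginSverak2009`]
* L. C. Evans, *Partial Differential Equations* (2010), §5.3.1, §5.8.2. [`Evans2010`]
-/

noncomputable section

open MeasureTheory Set Function Filter Topology TopologicalSpace Metric
open scoped NNReal ENNReal RealInnerProductSpace ContDiff

namespace Literature.Analysis.FluidPDE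

namespace NSBootstrap

open RepDeriv WkInfty Literature.Analysis.FunctionSpaces

/-- The restricted measure of a cylinder is the product of the restricted measures. [folklore] -/
theorem restrict_cyl_eq_prod (L ρ : ℝ) :
    (volume : Measure (ℝ × EuclideanSpace ℝ (Fin 3))).restrict (cyl L ρ) =
      (volume.restrict (Ioo (-L) 0)).prod (volume.restrict (ball (0 : EuclideanSpace ℝ (Fin 3)) ρ)) := by
  rw [cyl, Measure.volume_eq_prod, Measure.prod_restrict]

/-- Slices of a bounded measurable function on a cylinder are integrable on the ball. [folklore] -/
theorem ae_integrableOn_slice {L ρ : ℝ} {f : ℝ × EuclideanSpace ℝ (Fin 3) → ℝ} {K : ℝ≥0}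
    (hf : AEStronglyMeasurable f (volume.restrict (cyl L ρ)))
    (hb : ∀ᵐ q ∂(volume.restrict (cyl L ρ)), |f q| ≤ K) :
    ∀ᵐ t ∂(volume.restrict (Ioo (-L) 0)), IntegrableOn (fun x => f (t, x)) (ball (0 : EuclideanSpace ℝ (Fin 3)) ρ) := by
  haveI := isFiniteMeasure_restrict_cyl L ρ
  have hi : Integrable f (volume.restrict (cyl L ρ)) :=
    (memLp_top_of_bound hf K (hb.mono fun q hq => by rw [Real.norm_eq_abs]; exact hq)).integrable le_top
  rw [restrict_cyl_eq_prod] at hi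
  filter_upwards [hi.prod_right_ae] with t ht
  exact ht

set_option maxHeartbeats 3200000 in
/-- **Smooth slices with bounds fixed before the solution.** For `0 < r₀ < R`, an inner
cylinder `C(L', ρ')` (`0 < L' < r₀²`, `0 < ρ' < r₀`) and `r' < ρ'` there are constants `K_k` such
that for every bounded distributional Navier–Stokes solution `(u, p)` on `Q(0, R)` with
`|u| ≤ M` a.e. and `∫∫ |p|^{3/2} ≤ P`, every component `b` and a.e. `t ∈ ]-L', 0[`, the slice
`u_b(t, ·)` agrees a.e. on `B(0, r')` with a smooth function whose derivatives are bounded by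
`3ᵏ K_k` and which is `3K₁`-Lipschitz. [cite: SereginSverak2009, §2 p. 8] -/
theorem ae_smooth_slices {R r₀ L' ρ' r' : ℝ} (hr₀ : 0 < r₀) (hr₀R : r₀ < R) (hL' : 0 < L') (hL'r : L' < r₀ ^ 2)
    (hρ' : 0 < ρ') (hρ'r : ρ' < r₀) (hr'ρ : r' < ρ') (M : ℝ) (P : ℝ≥0) :
    ∃ Ks : ℕ → ℝ≥0, ∀ (u : ℝ → EuclideanSpace ℝ (Fin 3) → EuclideanSpace ℝ (Fin 3))
      (p : ℝ → EuclideanSpace ℝ (Fin 3) → ℝ),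
      IsDistributionalNSSolutionOn (parabolicCylinderOpens R (0 : ℝ × EuclideanSpace ℝ (Fin 3))) 1 0 u p →
      (∀ᵐ w ∂(volume.restrict (parabolicCylinder R (0 : ℝ × EuclideanSpace ℝ (Fin 3)))), ‖u w.1 w.2‖ ≤ M) →
      (∫⁻ w in parabolicCylinder R (0 : ℝ × EuclideanSpace ℝ (Fin 3)), ‖p w.1 w.2‖ₑ ^ (3 / 2 : ℝ) ≤ P) →
      ∀ b : Fin 3, ∀ᵐ t ∂(volume.restrict (Ioo (-L') 0)), ∃ v : EuclideanSpace ℝ (Fin 3) → ℝ,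
        (fun x => u t x b) =ᵐ[volume.restrict (ball (0 : EuclideanSpace ℝ (Fin 3)) r')] v ∧
        ContDiffOn ℝ ∞ v (ball (0 : EuclideanSpace ℝ (Fin 3)) r') ∧
        (∀ k : ℕ, ∀ x ∈ ball (0 : EuclideanSpace ℝ (Fin 3)) r', ‖iteratedFDeriv ℝ k v x‖ ≤ 3 ^ k * Ks k) ∧
        ∀ x ∈ ball (0 : EuclideanSpace ℝ (Fin 3)) r', ∀ y ∈ ball (0 : EuclideanSpace ℝ (Fin 3)) r',
          ‖v x - v y‖ ≤ 3 * Ks 1 * ‖x - y‖ := by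
  choose Kn hKn using fun n => all_levels n hr₀ hr₀R M P hL' hL'r hρ' hρ'r
  refine ⟨Kn, fun u p hsol hbd hP b => ?_⟩
  choose G U A hG hheat hpoi hdata using fun n => hKn n u p hsol hbd hP
  set Bρ : Set (EuclideanSpace ℝ (Fin 3)) := ball 0 ρ' with hBρ
  set I : Set ℝ := Ioo (-L') 0 with hI
  -- (S1) slices of the representatives: integrable and bounded
  have S1 : ∀ (n : ℕ) (γ : List (Fin 3)), γ.length ≤ n → ∀ᵐ t ∂(volume.restrict I),
      IntegrableOn (fun x => U n γ b (t, x)) Bρ ∧ ∀ᵐ x ∂(volume.restrict Bρ), |U n γ b (t, x)| ≤ Kn n := by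
    intro n γ hγ
    have hb := ((hdata n) γ hγ b b).2.2.1
    filter_upwards [ae_integrableOn_slice ((hdata n).aesm_U hγ b) hb,
      SerrinBoundedHolder.ae_ae_of_ae_restrict_prod hb] with t h1 h2
    exact ⟨h1, h2⟩
  -- (S2) consistency of the families
  have S2 : ∀ (n m : ℕ) (γ : List (Fin 3)), γ.length ≤ n → γ.length ≤ m → ∀ᵐ t ∂(volume.restrict I),
      (fun x => U n γ b (t, x)) =ᵐ[volume.restrict Bρ] fun x => U m γ b (t, x) := by
    intro n m γ hn hm
    have h := ((hdata n) γ hn b b).1.ae_eq ((hdata m) γ hm b b).1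
    have h' : ∀ᵐ q ∂(volume.restrict (cyl L' ρ')), U n γ b q = U m γ b q := (ae_restrict_cyl_iff).2 h
    exact SerrinBoundedHolder.ae_ae_of_ae_restrict_prod h'
  -- (S3) the first-order identities, sliced
  have S3 : ∀ (n : ℕ) (γ : List (Fin 3)) (i : Fin 3), γ.length + 1 ≤ n → ∀ᵐ t ∂(volume.restrict I),
      ∀ φ : EuclideanSpace ℝ (Fin 3) → ℝ, IsTestFunctionOn (⟨Bρ, isOpen_ball⟩ : Opens (EuclideanSpace ℝ (Fin 3))) φ →
        ∫ x, U n γ b (t, x) * fderiv ℝ φ x (frame i) = -∫ x, U n (i :: γ) b (t, x) * φ x := by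
    intro n γ i hγ
    have h1 := ((hdata n) γ (by omega) b b).1
    have h2 := ((hdata n) (i :: γ) (by simpa using hγ) b b).1
    rw [List.map_cons] at h2
    have h12 := h1.firstOrder_of_cons h2
    refine ae_slice_firstOrder (Ω := ⟨Bρ, isOpen_ball⟩) (a := -L') (b := 0) h1.locallyIntegrableOn
      h2.locallyIntegrableOn fun ψ hψ => ?_
    have h := h12.integral_eq hψ
    simpa [derivs_singleton] using h
  -- (S4) the velocity and its order-zero representatives
  have S4 : ∀ n : ℕ, ∀ᵐ t ∂(volume.restrict I), (fun x => u t x b) =ᵐ[volume.restrict Bρ] fun x => U n [] b (t, x) := by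
    intro n
    have h : ∀ᵐ q ∂(volume.restrict (cyl L' ρ')), u q.1 q.2 b = U n [] b q := (ae_restrict_cyl_iff).2 ((hdata n).ae_eq_U b)
    exact SerrinBoundedHolder.ae_ae_of_ae_restrict_prod h
  -- all at once
  have hall : ∀ᵐ t ∂(volume.restrict I),
      (∀ (n : ℕ) (γ : List (Fin 3)), γ.length ≤ n →
        IntegrableOn (fun x => U n γ b (t, x)) Bρ ∧ ∀ᵐ x ∂(volume.restrict Bρ), |U n γ b (t, x)| ≤ Kn n) ∧
      (∀ (n m : ℕ) (γ : List (Fin 3)), γ.length ≤ n → γ.length ≤ m →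
        (fun x => U n γ b (t, x)) =ᵐ[volume.restrict Bρ] fun x => U m γ b (t, x)) ∧
      (∀ (n : ℕ) (γ : List (Fin 3)) (i : Fin 3), γ.length + 1 ≤ n →
        ∀ φ : EuclideanSpace ℝ (Fin 3) → ℝ, IsTestFunctionOn (⟨Bρ, isOpen_ball⟩ : Opens (EuclideanSpace ℝ (Fin 3))) φ →
          ∫ x, U n γ b (t, x) * fderiv ℝ φ x (frame i) = -∫ x, U n (i :: γ) b (t, x) * φ x) ∧
      ((fun x => u t x b) =ᵐ[volume.restrict Bρ] fun x => U 0 [] b (t, x)) := by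
    have e1 : ∀ᵐ t ∂(volume.restrict I), ∀ (n : ℕ) (γ : List (Fin 3)), γ.length ≤ n →
        IntegrableOn (fun x => U n γ b (t, x)) Bρ ∧ ∀ᵐ x ∂(volume.restrict Bρ), |U n γ b (t, x)| ≤ Kn n := by
      refine ae_all_iff.2 fun n => ae_all_iff.2 fun γ => ?_
      by_cases hγ : γ.length ≤ n
      · exact (S1 n γ hγ).mono fun t ht _ => ht
      · exact Eventually.of_forall fun t h => absurd h hγ
    have e2 : ∀ᵐ t ∂(volume.restrict I), ∀ (n m : ℕ) (γ : List (Fin 3)), γ.length ≤ n → γ.length ≤ m →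
        (fun x => U n γ b (t, x)) =ᵐ[volume.restrict Bρ] fun x => U m γ b (t, x) := by
      refine ae_all_iff.2 fun n => ae_all_iff.2 fun m => ae_all_iff.2 fun γ => ?_
      by_cases hn : γ.length ≤ n
      · by_cases hm : γ.length ≤ m
        · exact (S2 n m γ hn hm).mono fun t ht _ _ => ht
        · exact Eventually.of_forall fun t _ h => absurd h hm
      · exact Eventually.of_forall fun t h => absurd h hn
    have e3 : ∀ᵐ t ∂(volume.restrict I), ∀ (n : ℕ) (γ : List (Fin 3)) (i : Fin 3), γ.length + 1 ≤ n →
        ∀ φ : EuclideanSpace ℝ (Fin 3) → ℝ, IsTestFunctionOn (⟨Bρ, isOpen_ball⟩ : Opens (EuclideanSpace ℝ (Fin 3))) φ →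
          ∫ x, U n γ b (t, x) * fderiv ℝ φ x (frame i) = -∫ x, U n (i :: γ) b (t, x) * φ x := by
      refine ae_all_iff.2 fun n => ae_all_iff.2 fun γ => ae_all_iff.2 fun i => ?_
      by_cases hγ : γ.length + 1 ≤ n
      · exact (S3 n γ i hγ).mono fun t ht _ => ht
      · exact Eventually.of_forall fun t h => absurd h hγ
    filter_upwards [e1, e2, e3, S4 0] with t h1 h2 h3 h4
    exact ⟨h1, h2, h3, h4⟩
  filter_upwards [hall] with t ht
  obtain ⟨h1, h2, h3, h4⟩ := ht
  -- the family of slices at `t`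
  set F : List (Fin 3) → EuclideanSpace ℝ (Fin 3) → ℝ := fun γ x => U γ.length γ b (t, x) with hF
  have hint : ∀ γ, IntegrableOn (F γ) (ball (0 : EuclideanSpace ℝ (Fin 3)) ρ') := fun γ => (h1 γ.length γ le_rfl).1
  have hbd' : ∀ γ, ∀ᵐ x ∂(volume.restrict (ball (0 : EuclideanSpace ℝ (Fin 3)) ρ')), |F γ x| ≤ Kn γ.length :=
    fun γ => (h1 γ.length γ le_rfl).2
  have hweak : ∀ (γ : List (Fin 3)) (i : Fin 3) (φ : EuclideanSpace ℝ (Fin 3) → ℝ),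
      IsTestFunctionOn (WkInfty.B 0 ρ') φ →
      ∫ x in ball (0 : EuclideanSpace ℝ (Fin 3)) ρ', F γ x * fderiv ℝ φ x (WkInfty.e i) =
        -∫ x in ball (0 : EuclideanSpace ℝ (Fin 3)) ρ', F (i :: γ) x * φ x := by
    intro γ i φ hφ
    have hφs : tsupport φ ⊆ Bρ := hφ.tsupport_subset
    have hφ0 : ∀ x ∉ Bρ, φ x = 0 := fun x hx => image_eq_zero_of_notMem_tsupport fun h => hx (hφs h)
    have hdφ0 : ∀ x ∉ Bρ, fderiv ℝ φ x (WkInfty.e i) = 0 := fun x hx => by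
      rw [fderiv_of_notMem_tsupport ℝ (fun h => hx (hφs h))]; rfl
    rw [setIntegral_eq_integral_of_forall_compl_eq_zero fun x hx => by rw [hdφ0 x hx, mul_zero],
      setIntegral_eq_integral_of_forall_compl_eq_zero fun x hx => by rw [hφ0 x hx, mul_zero]]
    -- replace the level-`|γ|` representative by the level-`|γ| + 1` one
    have hae := h2 γ.length (γ.length + 1) γ le_rfl (by omega)
    have hae' : ∀ᵐ x ∂(volume : Measure (EuclideanSpace ℝ (Fin 3))),
        F γ x * fderiv ℝ φ x (WkInfty.e i) = U (γ.length + 1) γ b (t, x) * fderiv ℝ φ x (WkInfty.e i) := by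
      have h' := (ae_restrict_iff' (measurableSet_ball (x := (0 : EuclideanSpace ℝ (Fin 3))) (ε := ρ'))).1 hae
      filter_upwards [h'] with x hx
      by_cases hxB : x ∈ Bρ
      · simp only [hF]; rw [hx hxB]
      · rw [hdφ0 x hxB, mul_zero, mul_zero]
    rw [integral_congr_ae hae']
    exact h3 (γ.length + 1) γ i le_rfl φ hφ
  obtain ⟨v, hv, hvs, hvb, hvl⟩ := exists_smooth_rep (x₀ := (0 : EuclideanSpace ℝ (Fin 3))) (K := Kn) hr'ρ hint hbd' hweak
  refine ⟨v, ?_, hvs, hvb, hvl⟩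
  have hsub : ball (0 : EuclideanSpace ℝ (Fin 3)) r' ⊆ Bρ := ball_subset_ball hr'ρ.le
  have h4' : (fun x => u t x b) =ᵐ[volume.restrict (ball (0 : EuclideanSpace ℝ (Fin 3)) r')] fun x => U 0 [] b (t, x) :=
    ae_restrict_of_ae_restrict_of_subset hsub h4
  exact h4'.trans hv

end NSBootstrap

end Literature.Analysis.FluidPDE

end
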